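import Mathlib
import HarnessLib
import Literature.Analysis.FluidPDE.ClassicalSolution
import Literature.Analysis.FluidPDE.ClassicalSolutionRescale
import Literature.Analysis.FluidPDE.ClassicalSolutionGlue
import Literature.Analysis.FluidPDE.SelfSimilar
import Literature.Analysis.FluidPDE.AxisymmetricEuler
import Literature.Analysis.FluidPDE.NSLerayStrongLocalExistence
import Literature.Analysis.FluidPDE.NSBoundedMildSmoothing
import Literature.Analysis.FluidPDE.KNSSOseenMildDecayOfLemma31
import Literature.Analysis.FluidPDE.KNSSWeakDriftMildProofs
import Literature.Analysis.FluidPDE.ChaeWolfRemovingDSSBounds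
import Literature.Analysis.FluidPDE.ChaeWolfRemovingDSSLimit
import Literature.Analysis.FluidPDE.KNSSBlowupLimit
import Summits.NavierStokesRegularity.NavierStokesRegularity.Theorems.TypeICertificateLadderTargetRssCompactnessPressureCover
import Summits.NavierStokesRegularity.NavierStokesRegularity.Theorems.LocalSineTubeDoorProfileAlignedWindowRigidityAncient
import Summits.NavierStokesRegularity.NavierStokesRegularity.Theorems.ZoomReturnDoorDefs
import Summits.NavierStokesRegularity.NavierStokesRegularity.Theorems.ZoomReturnDoorDssExtension
import Summits.NavierStokesRegularity.NavierStokesRegularity.Theorems.ZoomReturnDoorLimit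
import Summits.NavierStokesRegularity.NavierStokesRegularity.Theorems.ZoomReturnDoorExtraction
import Summits.NavierStokesRegularity.NavierStokesRegularity.Theorems.ZoomReturnDoorGlue
import Summits.NavierStokesRegularity.NavierStokesRegularity.Theorems.ZoomReturnDoorClassicalLimit

/-!
# ZoomReturnDoorBandStability — S25 «ZoomReturnDoor», kit part 7/7 §3: K-band `BandStability` and K-open
# `RemovableSetOpen` are TREE THEOREMS

`bandStability_holds : BandStability` and `removableSetOpen_holds : RemovableSetOpen` (texts of part 1 `ZoomReturnDoorDefs`,
nsreg-p1 ROUND-24 §2; CLAIMED in the memo, plan §3 B1–B5 / G1–G5), composed exactly as in the planner's skeleton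
(`bandStability_of_stubs` / `removableSetOpen_of_stubs`) from E1 `extraction`, E2 `classical_limit` (the kit's one stub,
proved in `ZoomReturnDoorClassicalLimit`), E3 `analytic_slices_of_decay`, B0/B4 glue, parts 5 (`dssExtend`) and 6
(`oneFactor_of_smallEcho_limit`, `oneFactor_of_dss_limit`).  Consequences (part 3/4 doors): `removable_all_of_isOpen_bad`,
`exists_minimalBadFactor`, `targetSmallEcho_of_bandStability`, `targetBand_of_bandStability`, `targetRestless_of_bandStability`
now apply with these theorems in place of their hypotheses — the remaining hypothesis of the band doors is the graded wall
`∀ κ ∈ Icc a b, RemovableFactor (M/ν) (√κ)⁻¹` (= Tsai Conj. 8.8 on the band; PROVED near one, `removable_nearOne`).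

Door family of LADDER-NS N0; THEOREMS-ONLY landing (lane ns-door-S23-p1, DIRECTOR-NS #73 (2)) of the nsreg-p1 g20 kit part 7/7
`run/shared/lean/pub/ns-regularity-ideate/ns-regularity-ideate-p1/r24/landing/ZoomReturnDoorSkeleton.lean` (ADDENDUM-24C rev 3,
93b5c61024a69aa0), split into three files ≤ 400 lines; its one stub E2 `stub_classical_limit` is the tree theorem
`ZoomReturnDoorClassicalLimit.classical_limit`. WHAT THIS IS NOT: not NS regularity; no route, no item.
-/

noncomputable section

set_option linter.dupNamespace false

namespace Summit.NavierStokesRegularity.NavierStokesRegularity.Theorems.ZoomReturnDoorBandStability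

open MeasureTheory Set Function Filter Topology Metric
open scoped ENNReal NNReal Topology
open Literature.Analysis Literature.Analysis.FluidPDE
open Summit.NavierStokesRegularity.NavierStokesRegularity.Theorems.ZoomReturnDoorDefs
open Summit.NavierStokesRegularity.NavierStokesRegularity.Theorems.ZoomReturnDoorDssExtension
open Summit.NavierStokesRegularity.NavierStokesRegularity.Theorems.ZoomReturnDoorLimit
open Summit.NavierStokesRegularity.NavierStokesRegularity.Theorems.ZoomReturnDoorExtraction
open Summit.NavierStokesRegularity.NavierStokesRegularity.Theorems.ZoomReturnDoorGlue
open Summit.NavierStokesRegularity.NavierStokesRegularity.Theorems.ZoomReturnDoorClassicalLimit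

/-! ## §3 The two claimed theorems, composed from E1–E3 and the glue -/

/-- **K-band `BandStability` HOLDS** (text of part 1 verbatim): composed from E1 `extraction`, E2 `classical_limit`,
E3 `analytic_slices_of_decay`, B0 normalisation, B2–B3 one-factor symmetry (part 6), G4 extension (part 5) and B4 "the extension
is classical" — exactly the planner's `bandStability_of_stubs` with the stub replaced by the tree theorem. -/
theorem bandStability_holds : BandStability := by
  intro ν D a b hν hD ha hb hrem U hU hUne hUbdd
  by_contra hbad
  have hbad' : ∀ ε : ℝ, 0 < ε → ∃ κ ∈ Icc a b, ∃ (u : ℝ → EuclideanSpace ℝ (Fin 3) → EuclideanSpace ℝ (Fin 3)) (p : ℝ → EuclideanSpace ℝ (Fin 3) → ℝ),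
      IsClassicalNSSolutionOn (Iio 0) 1 0 u p ∧ HasTypeIDecay D u ∧
      HasSmallEchoOn ν κ (Real.sqrt κ) ε U u ∧ ∃ t < 0, ∃ x, u t x ≠ 0 := by
    by_contra hno
    push Not at hno
    obtain ⟨ε, hε, hall⟩ := hno
    exact hbad ⟨ε, hε, hall⟩
  -- the horizon `s₁` and the witness time `T` depend on `a, b` only
  set s₁ : ℝ := -1 / (4 * a) - 1 with hs₁_def
  set T : ℝ := b * s₁ - 1 with hT_def
  obtain ⟨κ₀, hκ₀, -⟩ := hbad' 1 one_pos
  have hb0 : 0 < b := ha.trans_le (hκ₀.1.trans hκ₀.2)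
  have hquarter : 0 < 1 / (4 * a) := by positivity
  have hs₁e : s₁ = -(1 / (4 * a)) - 1 := by rw [hs₁_def]; ring
  have hs₁neg : s₁ < -1 := by linarith
  have hT1 : T ≤ -1 := by
    have : b * s₁ < 0 := mul_neg_of_pos_of_neg hb0 (by linarith)
    rw [hT_def]; linarith
  have hT0 : T < 0 := by linarith
  obtain ⟨η, hη, R, hnorm⟩ := normalise hD hT0
  -- the normalised bad sequence
  have hseq : ∀ n : ℕ, ∃ κ ∈ Icc a b, ∃ (v : ℝ → EuclideanSpace ℝ (Fin 3) → EuclideanSpace ℝ (Fin 3)) (q : ℝ → EuclideanSpace ℝ (Fin 3) → ℝ),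
      IsClassicalNSSolutionOn (Iio 0) 1 0 v q ∧ HasTypeIDecay D v ∧
      HasSmallEchoOn ν κ (Real.sqrt κ) (1 / ((n : ℝ) + 1)) U v ∧ ∃ z : EuclideanSpace ℝ (Fin 3), ‖z‖ ≤ R ∧ η ≤ ‖v T z‖ := by
    intro n
    obtain ⟨κ, hκ, u, p, hcl, hdec, hecho, hnt⟩ := hbad' (1 / ((n : ℝ) + 1)) (by positivity)
    obtain ⟨lam, hlam, z, hz, hηz⟩ := hnorm u p hcl hdec hnt
    exact ⟨κ, hκ, nsRescale lam u, nsRescalePressure lam p, isClassical_nsRescale hcl hlam,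
      hasTypeIDecay_nsRescale hdec hlam, hasSmallEchoOn_nsRescale hecho hlam, z, hz, hηz⟩
  choose κn hκn vn qn hcl hdec hecho zn hzn hηn using hseq
  -- E1: extraction
  obtain ⟨φ, v, hφ, hvc, hbw, hlu, hdecv, xbar, hxbar⟩ := extraction hD hT1 hcl hdec hzn hηn
  -- E2: the limit is classical below `-1/4` (`ZoomReturnDoorClassicalLimit.classical_limit`); E3: analytic slices
  obtain ⟨q, hclv⟩ := classical_limit hD hvc hbw hdecv
  obtain ⟨hL, hD'⟩ := bounds_of_decay hD hdecv
  have han := analytic_slices_of_decay hclv hL hD'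
  -- a convergent subsequence of the ratios, `κ ∈ [a, b]`
  obtain ⟨κ, hκmem, ψ, hψ, hκlim⟩ := isCompact_Icc.tendsto_subseq (x := κn ∘ φ) (fun n => hκn (φ n))
  have hκlim' : Tendsto (fun n => κn (φ (ψ n))) atTop (𝓝 κ) := hκlim
  have hκ0 : 0 < κ := ha.trans_le hκmem.1
  have hκ1 : κ < 1 := lt_of_le_of_lt hκmem.2 hb
  -- continuous convergence along `φ ∘ ψ`
  have hcc := tendsto_of_locUnif hlu hψ
  -- B2–B3 (part 6): one-factor symmetry of the limit below `κ s₁`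
  have hεn : Tendsto (fun n => 1 / (((φ (ψ n) : ℕ) : ℝ) + 1)) atTop (𝓝 0) := by
    have h1 : Tendsto (fun n => φ (ψ n)) atTop atTop := hφ.tendsto_atTop.comp hψ.tendsto_atTop
    exact (tendsto_one_div_add_atTop_nhds_zero_nat (𝕜 := ℝ)).comp h1
  have hslice : ∀ n, ∀ t < 0, Continuous (vn (φ (ψ n)) t) := fun n t ht =>
    ((hcl (φ (ψ n))).contDiff_velocity (by exact ht)).continuous
  have hs₁t : s₁ < -(1 / 4 : ℝ) := by linarith
  have has₁ : a * s₁ = -(1 / 4 : ℝ) - a := by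
    rw [hs₁e]; field_simp
  have hκs₁ : κ * s₁ < -(1 / 4 : ℝ) := by nlinarith [hκmem.1]
  have hκs₁0 : κ * s₁ < 0 := by linarith
  have hsym := oneFactor_of_smallEcho_limit hν (vn := fun n => vn (φ (ψ n))) (v := v)
    (κn := fun n => κn (φ (ψ n))) (εn := fun n => 1 / (((φ (ψ n) : ℕ) : ℝ) + 1)) (t₁ := -(1 / 4 : ℝ))
    hκ0 hκlim' (fun n => ha.trans_le (hκn (φ (ψ n))).1) hεn hslice hcc (fun t ht _ => han t ht) hU hUne
    (fun n => hecho (φ (ψ n))) (by linarith) hs₁t hκs₁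
  -- G4 (part 5): the DSS extension with factor `c = (√κ)⁻¹ > 1`
  have hc1 : 1 < (Real.sqrt κ)⁻¹ := by
    rw [one_lt_inv_iff₀]
    refine ⟨Real.sqrt_pos.2 hκ0, ?_⟩
    have := Real.sqrt_lt_sqrt hκ0.le hκ1
    rwa [Real.sqrt_one] at this
  obtain ⟨w, hdss, hdecw, hagree, hrep⟩ := exists_dss_extension hc1 hκs₁0 v hsym
    (fun t ht y => hdecv t (by linarith) y)
  -- B4: the extension is classical (proved, §2)
  obtain ⟨qw, hclw⟩ := extension_classical (t₁ := -(1 / 4 : ℝ)) hc1 hκs₁ hclv hrep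
  -- the factor `(√κ)⁻¹`, `κ ∈ [a, b]`, is removable by hypothesis
  have hzero := hrem κ hκmem w qw hclw hdss hdecw
  -- the witness survives: `T ≤ κ s₁`
  have hTle : T ≤ κ * s₁ := by
    have : b * s₁ ≤ κ * s₁ := by nlinarith [hκmem.2]
    rw [hT_def]; linarith
  have h0 : v T xbar = 0 := by rw [← hagree T hTle xbar]; exact hzero T hT0 xbar
  have : η ≤ 0 := by simpa [h0] using hxbar
  exact absurd this (not_le.2 hη)

/-- **K-open `RemovableSetOpen` HOLDS** (text of part 1 verbatim): from E1–E3, B0, G3 (part 6), G4 (part 5), B4 — the planner's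
`removableSetOpen_of_stubs` with the stub replaced by the tree theorem. -/
theorem removableSetOpen_holds : RemovableSetOpen := by
  intro D hD
  rw [Metric.isOpen_iff]
  rintro c₀ ⟨hc₀1, hremc₀⟩
  by_contra hno
  push Not at hno
  -- bad factors `cₙ → c₀`, `cₙ > 1`, with nontrivial normalised witnesses
  have hT0 : (-1 : ℝ) < 0 := by norm_num
  obtain ⟨η, hη, R, hnorm⟩ := normalise hD hT0
  have hseq : ∀ n : ℕ, ∃ c : ℝ, |c - c₀| < 1 / ((n : ℝ) + 1) ∧ 1 < c ∧ ∃ (v : ℝ → EuclideanSpace ℝ (Fin 3) → EuclideanSpace ℝ (Fin 3)) (q : ℝ → EuclideanSpace ℝ (Fin 3) → ℝ),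
      IsClassicalNSSolutionOn (Iio 0) 1 0 v q ∧ IsDiscretelySelfSimilar c v ∧ HasTypeIDecay D v ∧
      ∃ z : EuclideanSpace ℝ (Fin 3), ‖z‖ ≤ R ∧ η ≤ ‖v (-1) z‖ := by
    intro n
    have hpos : 0 < min (1 / ((n : ℝ) + 1)) ((c₀ - 1) / 2) := lt_min (by positivity) (by linarith)
    obtain ⟨c, hc, hnot⟩ := Set.not_subset.1 (hno _ hpos)
    rw [Metric.mem_ball, Real.dist_eq] at hc
    have hc1 : 1 < c := by
      have h2 : |c - c₀| < (c₀ - 1) / 2 := hc.trans_le (min_le_right _ _)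
      have h3 := (abs_lt.1 h2).1
      linarith
    have hnotR : ¬ RemovableFactor D c := fun hr => hnot ⟨hc1, hr⟩
    have hex : ∃ (u : ℝ → EuclideanSpace ℝ (Fin 3) → EuclideanSpace ℝ (Fin 3)) (p : ℝ → EuclideanSpace ℝ (Fin 3) → ℝ), IsClassicalNSSolutionOn (Iio 0) 1 0 u p ∧
        IsDiscretelySelfSimilar c u ∧ HasTypeIDecay D u ∧ ∃ t < 0, ∃ x, u t x ≠ 0 := by
      by_contra hall
      push Not at hall
      exact hnotR fun u p h1 h2 h3 => hall u p h1 h2 h3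
    obtain ⟨u, p, hcl, hdss, hdec, hnt⟩ := hex
    obtain ⟨lam, hlam, z, hz, hηz⟩ := hnorm u p hcl hdec hnt
    exact ⟨c, hc.trans_le (min_le_left _ _), hc1, nsRescale lam u, nsRescalePressure lam p,
      isClassical_nsRescale hcl hlam, isDiscretelySelfSimilar_nsRescale hdss, hasTypeIDecay_nsRescale hdec hlam,
      z, hz, hηz⟩
  choose cn hcn hcn1 vn qn hcl hdss hdec zn hzn hηn using hseq
  have hcnlim : Tendsto cn atTop (𝓝 c₀) := by
    rw [Metric.tendsto_atTop]
    intro ε hε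
    obtain ⟨N, hN⟩ := exists_nat_one_div_lt hε
    refine ⟨N, fun n hn => ?_⟩
    rw [Real.dist_eq]
    have h1 : 1 / ((n : ℝ) + 1) ≤ 1 / ((N : ℝ) + 1) := by
      apply one_div_le_one_div_of_le (by positivity)
      exact_mod_cast Nat.add_le_add_right hn 1
    exact (hcn n).trans_le (h1.trans hN.le)
  -- E1–E3, then continuous convergence along `φ`
  obtain ⟨φ, v, hφ, hvc, hbw, hlu, hdecv, xbar, hxbar⟩ := extraction hD le_rfl hcl hdec hzn hηn
  obtain ⟨q, hclv⟩ := classical_limit hD hvc hbw hdecv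
  obtain ⟨hL, hD'⟩ := bounds_of_decay hD hdecv
  have han := analytic_slices_of_decay hclv hL hD'
  have hcc := tendsto_of_locUnif hlu strictMono_id
  -- G3 (part 6): the limit is `c₀`-DSS on `t < -1/4`
  have hdss' : ∀ n t x, vn (φ (id n)) t x = cn (φ (id n)) • vn (φ (id n)) (cn (φ (id n)) ^ 2 * t) (cn (φ (id n)) • x) := by
    intro n t x
    have := congrFun (congrFun (hdss (φ (id n))) t) x
    rw [nsRescale_apply] at this
    exact this.symm
  have hsym := oneFactor_of_dss_limit (vn := fun n => vn (φ (id n))) (v := v) (cn := fun n => cn (φ (id n)))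
    (t₁ := -(1 / 4 : ℝ)) (by norm_num) hc₀1.le (hcnlim.comp hφ.tendsto_atTop) hdss' hcc
  -- G4 (part 5): the DSS extension of `v|_{t ≤ -1/2}` with factor `c₀`
  obtain ⟨w, hdssw, hdecw, hagree, hrep⟩ := exists_dss_extension hc₀1 (t₀ := -(1 / 2 : ℝ)) (by norm_num) v
    (fun t ht x => hsym t (by linarith) x) (fun t ht y => hdecv t (by linarith) y)
  -- B4 (§2): classical on `Iio 0`
  obtain ⟨qw, hclw⟩ := extension_classical (t₁ := -(1 / 4 : ℝ)) hc₀1 (by norm_num) hclv hrep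
  have hzero := hremc₀ w qw hclw hdssw hdecw
  have h0 : v (-1) xbar = 0 := by
    rw [← hagree (-1) (by norm_num) xbar]; exact hzero (-1) (by norm_num) xbar
  have : η ≤ 0 := by simpa [h0] using hxbar
  exact absurd this (not_le.2 hη)

end Summit.NavierStokesRegularity.NavierStokesRegularity.Theorems.ZoomReturnDoorBandStability

end
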